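import Summits.HodgeConjecture.HodgeConjecture.Theorems.EightfoldBlochSeedsChernCharacterOnBettiAnalytificationFlagChern
import Summits.HodgeConjecture.HodgeConjecture.Theorems.EightfoldBlochSeedsChernCharacterOnBettiAnalytificationPullbackVectorBundle
import Literature.AlgebraicGeometry.HodgeTheory.ConiveauDescentGysinSection
import HarnessLib

/-!
# K1 → the CHERN CLASSES of every vector bundle are algebraic, given a flag map with a Gysin section

Route `EightfoldBlochSeeds` / item `stmt-HodgeConjecture-19780` (`ChernCharacterOnBetti`), helper
(`--supports`). HONEST FRAMING: nothing here proves 19780 / 18880 / 18882 / 18883 / H2 / HC_AV / HC;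
no definition, no named fact.

WHAT. Companion of `…AnalytificationSplitting` (there: the Chern character) for the Chern classes
`cᵢ(E)_ℂ = theChernClassTheory.chernClassIn ℂ E i` (Fulton Prop. 19.1.2 as needed by Kleiman-type
arguments): for `X` smooth projective, `F` a vector bundle on `X`, a flag map `g : Y ⟶ X` (smooth
projective `Y` of dimension `dim X + d`, `g^*F` with a full flag) with a divisor class `ξ` on `Y`,
`g_*(ξᵈ) = a · 1`, `a ≠ 0` (classically the complete flag bundle, Grothendieck 1958 §2 / Fulton §3.2 with
Prop. 3.1 (a)), and EVERY analytification datum `(E, α)` of `F`: `cᵢ(E)_ℂ ∈ algebraicClasses X i` for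
all `i` (`chernClassIn_complex_mem_algebraicClasses_of_comparison_of_flagMap`), from the naturality of
the Chern classes of analytifications (`chernClassZ_pullback_of_comparison`, K1e), the flagged case
(`chernClassIn_complex_mem_algebraicClasses_of_comparison_of_hasFullFlag`) and the descent of coniveau
(`mem_algebraicClasses_of_map_mem_of_complexGysin_cupPowTwo_eq_smul`).

[cite: Grothendieck1958, §2] [cite: Fulton1998, §3.1 Prop. 3.1 (a), §3.2 and Prop. 19.1.2]
[cite: Voisin2025, §4.3] [cite: SerreGAGA1956, §3 n°11] [cite: HusemollerFibreBundles1994, Ch. 17 §3 (C₁)]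
-/

noncomputable section

-- single-problem summit (Problem = Summit): the mandated namespace repeats `HodgeConjecture`.
set_option linter.dupNamespace false

open CategoryTheory AlgebraicGeometry Bundle Topology
open Literature.AlgebraicGeometry.Motives Literature.AlgebraicGeometry.HodgeTheory Literature.AlgebraicGeometry.Modules
open Literature.AlgebraicTopology.SingularHomology Literature.AlgebraicTopology.CharacteristicClasses

namespace Summit.HodgeConjecture.HodgeConjecture.Theorems

variable {n m d : ℕ} {X Y : SchemeOver ℂ} {F : X.left.Modules} {r : ℕ}

/-- **`cᵢ(F(ℂ))_ℂ ∈ algebraicClasses X i` for every vector bundle `F` on a smooth projective `X`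
admitting a flag map with a Gysin section**, every analytification datum `(E, α)` of `F` and every
`i`. [cite: Grothendieck1958, §2] [cite: Fulton1998, §3.1 Prop. 3.1 (a), §3.2 and Prop. 19.1.2]
[cite: Voisin2025, §4.3] -/
theorem chernClassIn_complex_mem_algebraicClasses_of_comparison_of_flagMap (hX : IsSmoothProjective n X)
    (μ : OrientationFamily) (hμ : μ.HasPoincareDuality) (hY : IsSmoothProjective m Y) (g : Y ⟶ X)
    (hmd : n + d = m) {ξ : complexBetti Y 2} (hξ : ξ ∈ algebraicClasses Y 1) {a : ℂ} (ha : a ≠ 0)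
    (hone : complexGysin μ hY hX g (show 2 * d + 2 * n = 0 + 2 * m by omega) (cupPowTwo ξ d) =
      a • singularCohomology.one ℂ (ComplexPoints X))
    (hF : IsVectorBundle F) (hflag : HasFullFlag ((Scheme.Modules.pullback g.left).obj F))
    (hFr : ∀ x : X.left, ∃ (U : X.left.Opens) (s : Fin r → Γ(F, U)), x ∈ U ∧ IsSectionFrame F U s)
    (E : ComplexVectorBundle.{0, 0} (ComplexPoints X))
    (α : ∀ U : X.left.Opens, Γ(F, U) → ∀ P : ComplexPoints X, E.E P)
    (hadd : ∀ (U : X.left.Opens) (σ τ : Γ(F, U)) (P : ComplexPoints X), α U (σ + τ) P = α U σ P + α U τ P)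
    (hsmul : ∀ (U : X.left.Opens) (f : Γ(X.left, U)) (σ : Γ(F, U)) (P : ComplexPoints X) (h : P.pt ∈ U),
      α U (f • σ) P = P.eval U h f • α U σ P)
    (hres : ∀ (U W : X.left.Opens) (hWU : W ≤ U) (σ : Γ(F, U)) (P : ComplexPoints X), P.pt ∈ W →
      α W (F.presheaf.map (homOfLE hWU).op σ) P = α U σ P)
    (hcont : ∀ (U : X.left.Opens) (σ : Γ(F, U)),
      ContinuousOn (fun P ↦ (⟨P, α U σ P⟩ : TotalSpace E.F E.E)) {P | P.pt ∈ U})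
    (hframe : ∀ (U : X.left.Opens) (t : Fin r → Γ(F, U)), IsSectionFrame F U t →
      ∀ P : ComplexPoints X, P.pt ∈ U → LinearIndependent ℂ (fun j ↦ α U (t j) P) ∧
        ⊤ ≤ Submodule.span ℂ (Set.range fun j ↦ α U (t j) P)) (i : ℕ) :
    theChernClassTheory.chernClassIn ℂ E i ∈ algebraicClasses X i := by
  haveI := IsSmoothProjective.isIntegral_holds hX
  haveI := IsSmoothProjective.isIntegral_holds hY
  obtain ⟨r₀, hFr₀⟩ := exists_free_fin_iso_of_isVectorBundle hF
  have hF' : IsVectorBundle ((Scheme.Modules.pullback g.left).obj F) :=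
    ((isFiniteLocallyFree_of_isVectorBundle hF).pullback g.left).isVectorBundle
  obtain ⟨r', E', α', -, hfr', hadd', hsmul', hres', hcont', hframe'⟩ :=
    exists_topologicalAnalytification_of_isVectorBundle hY hF'
  obtain ⟨x₀⟩ := (inferInstance : Nonempty X.left)
  obtain rfl : r = r₀ := by
    obtain ⟨U, e, hx⟩ := hFr₀ x₀
    obtain ⟨U₁, s₁, hx₁, hs₁⟩ := hFr x₀
    exact frame_card_eq hs₁ (isSectionFrame_basisSection e (Equiv.refl _)) hx₁ hx
  obtain ⟨y₀⟩ := (inferInstance : Nonempty Y.left)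
  obtain rfl : r' = r := by
    obtain ⟨U, e, hx⟩ := hFr₀ (g.left.base y₀)
    obtain ⟨U₂, s₂, hy₂, hs₂⟩ := hfr' y₀
    exact frame_card_eq hs₂ (isSectionFrame_unitSection g e (Equiv.refl _)) hy₂ hx
  -- `g^* cᵢ(E)_ℂ = cᵢ(E')_ℂ` (K1e, integrally, then change of coefficients)
  have hZ := chernClassZ_pullback_of_comparison g hX hY hFr₀ E E' α α' hadd hsmul hres hcont hframe hadd' hsmul'
    hres' hcont' hframe' i
  have hpull : complexBetti.map g (2 * i) (theChernClassTheory.chernClassIn ℂ E i) =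
      theChernClassTheory.chernClassIn ℂ E' i := by
    change singularCohomology.map ℂ ℂ (AlgPoints.mapContinuous g) (2 * i)
      (singularCohomology.ringChange (Int.castRingHom ℂ) (ComplexPoints X) (2 * i) (chernClassZ E i)) =
      singularCohomology.ringChange (Int.castRingHom ℂ) (ComplexPoints Y) (2 * i) (chernClassZ E' i)
    rw [← Literature.AlgebraicTopology.CharacteristicClasses.ringChange_map, hZ]
  have hY' := chernClassIn_complex_mem_algebraicClasses_of_comparison_of_hasFullFlag hY hflag hfr' E' α'
    hadd' hsmul' hres' hcont' hframe' i
  refine mem_algebraicClasses_of_map_mem_of_complexGysin_cupPowTwo_eq_smul μ hμ hY hX g hmd hξ ha hone ?_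
  rw [hpull]
  exact hY'

end Summit.HodgeConjecture.HodgeConjecture.Theorems

end
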